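import Summits.KontsevichZagierPeriods.KontsevichZagierPeriods.Theorems.LiftingCriteriaCubeNashNormalFormReduction
import Summits.KontsevichZagierPeriods.KontsevichZagierPeriods.Theorems.LiftingCriteriaCubeNashNormalFormCells
import Summits.KontsevichZagierPeriods.KontsevichZagierPeriods.Theorems.LiftingCriteriaCubeNashNormalFormVolumeTwo
import Summits.KontsevichZagierPeriods.KontsevichZagierPeriods.Theorems.LiftingCriteriaCubeNashNormalFormTame

/-!
# `CubeNashNormalForm` (stmt-KontsevichZagierPeriods-3574): the case of dimension `≤ 1`,
# unconditionally, and the item from resolution in dimension `≥ 3`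

Support file for the item `CubeNashNormalForm` of route `LiftingCriteria`, assembling
`CubeNashNormalFormReduction` (reduction to bounded volumes; dimension-one volumes),
`CubeNashNormalFormVolumeTwo` (bounded plane volumes → one-dimensional representations on algebraic
intervals, by cylindrical decomposition and Newton–Leibniz) and `CubeNashNormalFormCells` /
`CubeNashNormalFormHalfCell` (one-dimensional representations on algebraic intervals → cube–Nash
generators, by the piecewise-analytic structure of one-variable `ℚ`-semialgebraic functions and
ramified real Puiseux charts at the algebraic break points):

* `of_mem_of_dim_le_one`: every representation of dimension `≤ 1` lies in every subgroup
  containing the relations and the cube–Nash generators;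
* `cubeNashNormalForm_dim_le_one`: the conclusion of the item for all pairs of rational
  representations of dimensions `k, k' ≤ 1` (no rationality needed), unconditionally;
* `cubeNashNormalForm_of_volume_three`: the item follows from the cube–Nash normal form of
  BOUNDED VOLUMES `∫_K 1`, `K ⊆ ℝ^{m+3}` — the remaining input is exactly embedded resolution of the
  boundary of a bounded `ℚ`-semialgebraic solid in ambient dimension `≥ 3`
  (Hironaka / Bierstone–Milman rectilinearization), not in the tree;
* `cubeNashNormalForm_of_boundedCubeResolution_three`: the same with TAME cube classes
  (`ReducedPeriodRing.cubicalSpan`, the span of stub S1 of crux `FurushoPentagon.SectorToKernel`) in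
  place of cube–Nash generators, by `CubeNashNormalFormTame.of_mem_of_isTameCube` — so this item and
  the cube-resolution stubs S1 (stmt-10813) / S1b (stmt-3929) wait on one and the same statement.
[Kontsevich–Zagier 2001, §1.2; Ayoub 2014, Rem. 12; Belkale–Brosnan 2003, Thm. 2.1 for the shape of
the missing input]
-/

noncomputable section

open Set MeasureTheory Filter Topology
open Literature.ModelTheory.ExponentialFields (IsSemialgebraic)
open Literature.NumberTheory.Transcendental
open Literature.NumberTheory.Transcendental.KZ
open Summit.KontsevichZagierPeriods.LiftingCriteria.CubeNashNormalFormReduction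
  (of_mem_of_dim_one exists_normalForm_of_mem_sup cubeNashNormalForm_of_volume)
open Summit.KontsevichZagierPeriods.LiftingCriteria.CubeNashNormalFormCells (of_mem_of_Ioo)
open Summit.KontsevichZagierPeriods.LiftingCriteria.CubeNashNormalFormVolumeTwo (of_mem_of_volume_two)
open Summit.KontsevichZagierPeriods.LiftingCriteria.CubeNashNormalFormTame (of_mem_of_isTameCube)

namespace Summit.KontsevichZagierPeriods.LiftingCriteria.CubeNashNormalFormDimLeOne

/-- **Representations of dimension `≤ 1` lie in the subgroup generated by the relations and the
cube–Nash representations**: `[r] ≡ [A] − [B]` with bounded volumes `A, B` of dimension `k + 1 ≤ 2`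
(`KZ.exists_sub_isBounded`); dimension-one volumes by `of_mem_of_dim_one`, bounded plane volumes
by `of_mem_of_volume_two` and `of_mem_of_Ioo`. [cite: KontsevichZagier2001, §1.2] -/
theorem of_mem_of_dim_le_one (N : AddSubgroup FormalRep) (hrel : relations ≤ N)
    (hgen : ∀ {m : ℕ} (t : IntegralRep m) (g : (Fin m → ℝ) → ℝ) (U : Set (Fin m → ℝ)),
      IsOpen U → Set.pi Set.univ (fun _ : Fin m => Set.Icc (0:ℝ) 1) ⊆ U →
      IsSemialgebraicFunOn ℚ U g → AnalyticOnNhd ℝ g U →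
      t.domain = Set.pi Set.univ (fun _ : Fin m => Set.Icc (0:ℝ) 1) →
      (∀ z ∈ Set.pi Set.univ (fun _ : Fin m => Set.Icc (0:ℝ) 1), t.integrand z = g z) → of t ∈ N)
    {k : ℕ} (hk : k ≤ 1) (r : IntegralRep k) : of r ∈ N := by
  obtain ⟨A, B, hAb, hBb, hA1, hB1, e⟩ := exists_sub_isBounded r
  have hvol : ∀ K : IntegralRep (k + 1), Bornology.IsBounded K.domain →
      (∀ x ∈ K.domain, K.integrand x = 1) → of K ∈ N := by
    intro K hKb hK1
    obtain rfl | rfl : k = 0 ∨ k = 1 := by omega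
    · exact of_mem_of_dim_one N hrel hgen K hK1
    · exact of_mem_of_volume_two N hrel
        (fun b c c' hcc' hc hc' hbd => of_mem_of_Ioo N hrel hgen b hcc' hc hc' hbd) K hK1 hKb
  have : of r = (of r - (of A - of B)) + of A - of B := by abel
  rw [this]
  exact N.sub_mem (N.add_mem (hrel e) (hvol A hAb hA1)) (hvol B hBb hB1)

/-- **`CubeNashNormalForm` in dimensions `≤ 1`, unconditionally**: for representations `r, r'` of
dimensions `k, k' ≤ 1`, `[r] − [r']` is, modulo the Kontsevich–Zagier relations, a `ℤ`-combination
of cube–Nash representations (rationality of `r, r'` is not needed). [cite: KontsevichZagier2001, §1.2] -/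
theorem cubeNashNormalForm_dim_le_one {k k' : ℕ} (hk : k ≤ 1) (hk' : k' ≤ 1) (r : IntegralRep k)
    (r' : IntegralRep k') :
    ∃ (S : ℕ) (n : Fin S → ℕ) (g : (i : Fin S) → (Fin (n i) → ℝ) → ℝ)
      (U : (i : Fin S) → Set (Fin (n i) → ℝ)) (ε : Fin S → ℤ) (s : (i : Fin S) → IntegralRep (n i)),
      (∀ i, IsOpen (U i) ∧ Set.pi Set.univ (fun _ : Fin (n i) => Set.Icc (0:ℝ) 1) ⊆ (U i) ∧
        IsSemialgebraicFunOn ℚ (U i) (g i) ∧ AnalyticOnNhd ℝ (g i) (U i)) ∧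
      (∀ i, (s i).domain = Set.pi Set.univ (fun _ : Fin (n i) => Set.Icc (0:ℝ) 1) ∧
        ∀ z ∈ Set.pi Set.univ (fun _ : Fin (n i) => Set.Icc (0:ℝ) 1), (s i).integrand z = g i z) ∧
      of r - of r' - ∑ i, ε i • of (s i) ∈ relations := by
  set N : AddSubgroup FormalRep := relations ⊔ AddSubgroup.closure {x : FormalRep | ∃ (m : ℕ)
      (t : IntegralRep m) (g : (Fin m → ℝ) → ℝ) (U : Set (Fin m → ℝ)), IsOpen U ∧
      Set.pi Set.univ (fun _ : Fin m => Set.Icc (0:ℝ) 1) ⊆ U ∧ IsSemialgebraicFunOn ℚ U g ∧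
      AnalyticOnNhd ℝ g U ∧ t.domain = Set.pi Set.univ (fun _ : Fin m => Set.Icc (0:ℝ) 1) ∧
      (∀ z ∈ Set.pi Set.univ (fun _ : Fin m => Set.Icc (0:ℝ) 1), t.integrand z = g z) ∧ x = of t}
    with hN
  have hrel : relations ≤ N := le_sup_left
  have hgen : ∀ {m : ℕ} (t : IntegralRep m) (g : (Fin m → ℝ) → ℝ) (U : Set (Fin m → ℝ)),
      IsOpen U → Set.pi Set.univ (fun _ : Fin m => Set.Icc (0:ℝ) 1) ⊆ U →
      IsSemialgebraicFunOn ℚ U g → AnalyticOnNhd ℝ g U →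
      t.domain = Set.pi Set.univ (fun _ : Fin m => Set.Icc (0:ℝ) 1) →
      (∀ z ∈ Set.pi Set.univ (fun _ : Fin m => Set.Icc (0:ℝ) 1), t.integrand z = g z) → of t ∈ N :=
    fun t g U h1 h2 h3 h4 h5 h6 =>
      AddSubgroup.mem_sup_right (AddSubgroup.subset_closure ⟨_, t, g, U, h1, h2, h3, h4, h5, h6, rfl⟩)
  exact exists_normalForm_of_mem_sup
    (N.sub_mem (of_mem_of_dim_le_one N hrel hgen hk r) (of_mem_of_dim_le_one N hrel hgen hk' r'))

/-- **`CubeNashNormalForm` from the cube–Nash normal form of bounded volumes of dimension `≥ 3`.**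
The plane case of the hypothesis of `cubeNashNormalForm_of_volume` is discharged by
`of_mem_of_volume_two` and `of_mem_of_Ioo`; what remains is the statement for bounded
`K = ∫_S 1`, `S ⊆ ℝ^{m+3}` — embedded resolution of `∂S` over `ℝ` (not in the tree).
[cite: KontsevichZagier2001, §1.2; BelkaleBrosnan2003, Thm. 2.1] -/
theorem cubeNashNormalForm_of_volume_three
    (H : ∀ (m : ℕ) (K : IntegralRep (m + 3)), Bornology.IsBounded K.domain →
      (∀ x ∈ K.domain, K.integrand x = 1) →
      ∃ (S : ℕ) (n : Fin S → ℕ) (g : (i : Fin S) → (Fin (n i) → ℝ) → ℝ)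
        (U : (i : Fin S) → Set (Fin (n i) → ℝ)) (ε : Fin S → ℤ) (s : (i : Fin S) → IntegralRep (n i)),
        (∀ i, IsOpen (U i) ∧ Set.pi Set.univ (fun _ : Fin (n i) => Set.Icc (0:ℝ) 1) ⊆ (U i) ∧
          IsSemialgebraicFunOn ℚ (U i) (g i) ∧ AnalyticOnNhd ℝ (g i) (U i)) ∧
        (∀ i, (s i).domain = Set.pi Set.univ (fun _ : Fin (n i) => Set.Icc (0:ℝ) 1) ∧
          ∀ z ∈ Set.pi Set.univ (fun _ : Fin (n i) => Set.Icc (0:ℝ) 1), (s i).integrand z = g i z) ∧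
        of K - ∑ i, ε i • of (s i) ∈ relations) :
    Summit.KontsevichZagierPeriods.KontsevichZagierPeriods.Theses.LiftingCriteria.CubeNashNormalForm := by
  refine cubeNashNormalForm_of_volume fun m K hKb hK1 => ?_
  cases m with
  | succ m => exact H m K hKb hK1
  | zero =>
    set N : AddSubgroup FormalRep := relations ⊔ AddSubgroup.closure {x : FormalRep | ∃ (m : ℕ)
        (t : IntegralRep m) (g : (Fin m → ℝ) → ℝ) (U : Set (Fin m → ℝ)), IsOpen U ∧
        Set.pi Set.univ (fun _ : Fin m => Set.Icc (0:ℝ) 1) ⊆ U ∧ IsSemialgebraicFunOn ℚ U g ∧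
        AnalyticOnNhd ℝ g U ∧ t.domain = Set.pi Set.univ (fun _ : Fin m => Set.Icc (0:ℝ) 1) ∧
        (∀ z ∈ Set.pi Set.univ (fun _ : Fin m => Set.Icc (0:ℝ) 1), t.integrand z = g z) ∧ x = of t}
      with hN
    have hrel : relations ≤ N := le_sup_left
    have hgen : ∀ {m : ℕ} (t : IntegralRep m) (g : (Fin m → ℝ) → ℝ) (U : Set (Fin m → ℝ)),
        IsOpen U → Set.pi Set.univ (fun _ : Fin m => Set.Icc (0:ℝ) 1) ⊆ U →
        IsSemialgebraicFunOn ℚ U g → AnalyticOnNhd ℝ g U →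
        t.domain = Set.pi Set.univ (fun _ : Fin m => Set.Icc (0:ℝ) 1) →
        (∀ z ∈ Set.pi Set.univ (fun _ : Fin m => Set.Icc (0:ℝ) 1), t.integrand z = g z) →
        of t ∈ N :=
      fun t g U h1 h2 h3 h4 h5 h6 =>
        AddSubgroup.mem_sup_right (AddSubgroup.subset_closure ⟨_, t, g, U, h1, h2, h3, h4, h5, h6, rfl⟩)
    exact exists_normalForm_of_mem_sup (of_mem_of_volume_two N hrel
      (fun b c c' hcc' hc hc' hbd => of_mem_of_Ioo N hrel hgen b hcc' hc hc' hbd) K hK1 hKb)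

/-- **`CubeNashNormalForm` from the tame-cube resolution of bounded volumes of dimension `≥ 3`.**
See the module docstring. [cite: KontsevichZagier2001, §1.2; Ayoub2014, Rem. 12] -/
theorem cubeNashNormalForm_of_boundedCubeResolution_three
    (h : ∀ (m : ℕ) (K : IntegralRep (m + 3)), Bornology.IsBounded K.domain →
      (∀ x ∈ K.domain, K.integrand x = 1) → ∃ c : FormalRep,
        c ∈ Summit.KontsevichZagierPeriods.FurushoPentagon.ReducedPeriodRing.cubicalSpan ∧
          of K - c ∈ relations) :
    Summit.KontsevichZagierPeriods.KontsevichZagierPeriods.Theses.LiftingCriteria.CubeNashNormalForm := by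
  refine cubeNashNormalForm_of_volume_three fun m K hKb hK1 => ?_
  set N : AddSubgroup FormalRep := relations ⊔ AddSubgroup.closure {x : FormalRep | ∃ (m : ℕ)
      (t : IntegralRep m) (g : (Fin m → ℝ) → ℝ) (U : Set (Fin m → ℝ)), IsOpen U ∧
      Set.pi Set.univ (fun _ : Fin m => Set.Icc (0:ℝ) 1) ⊆ U ∧ IsSemialgebraicFunOn ℚ U g ∧
      AnalyticOnNhd ℝ g U ∧ t.domain = Set.pi Set.univ (fun _ : Fin m => Set.Icc (0:ℝ) 1) ∧
      (∀ z ∈ Set.pi Set.univ (fun _ : Fin m => Set.Icc (0:ℝ) 1), t.integrand z = g z) ∧ x = of t}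
    with hN
  have hrel : relations ≤ N := le_sup_left
  have hgen : ∀ {m : ℕ} (t : IntegralRep m) (g : (Fin m → ℝ) → ℝ) (U : Set (Fin m → ℝ)),
      IsOpen U → Set.pi Set.univ (fun _ : Fin m => Set.Icc (0:ℝ) 1) ⊆ U →
      IsSemialgebraicFunOn ℚ U g → AnalyticOnNhd ℝ g U →
      t.domain = Set.pi Set.univ (fun _ : Fin m => Set.Icc (0:ℝ) 1) →
      (∀ z ∈ Set.pi Set.univ (fun _ : Fin m => Set.Icc (0:ℝ) 1), t.integrand z = g z) → of t ∈ N :=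
    fun t g U h1 h2 h3 h4 h5 h6 =>
      AddSubgroup.mem_sup_right (AddSubgroup.subset_closure ⟨_, t, g, U, h1, h2, h3, h4, h5, h6, rfl⟩)
  have hspan : Summit.KontsevichZagierPeriods.FurushoPentagon.ReducedPeriodRing.cubicalSpan ≤ N := by
    refine (AddSubgroup.closure_le _).2 ?_
    rintro _ ⟨m, t, htd, hta, rfl⟩
    exact of_mem_of_isTameCube N hrel hgen t ⟨htd, hta⟩
  obtain ⟨c, hc, e⟩ := h m K hKb hK1
  refine exists_normalForm_of_mem_sup ?_
  have : of K = (of K - c) + c := by abel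
  rw [this]
  exact N.add_mem (hrel e) (hspan hc)

end Summit.KontsevichZagierPeriods.LiftingCriteria.CubeNashNormalFormDimLeOne
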